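import Summits.CriticalPhenomena.CardyFormulaZ2.Theorems.CardySelfRefinementCriticalPathRSWStubPhaseDiagramLandmarksBPathLift

/-!
# Stub `stub_phaseDiagramLandmarksB` of line `finite-size-envelope` — part 2: transfer of crossings

Route `CardySelfRefinement`, crux `CriticalPathRSW` (stmt-CriticalPhenomena-10267), line
`finite-size-envelope`, stub `stub_phaseDiagramLandmarksB`.

Deterministic transfer of left-right box crossings between the fine lattice `ℤ²` and the coarse
lattice `kℤ²` (drawn on `ℤ²` by `u ↦ k u`; boxes `KST2023.box`, crossings `KST2023.crossing`):

* **fine to coarse** (`coarse_mem_crossing_of_fine`): if every open lattice edge of `ω ⊆ E(ℤ²)` is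
  axial for `k ≥ 2` (interior edges closed) and `ω` crosses `[-ka, ka] × [-kb, kb]`, then any coarse
  configuration containing the coarse edges all of whose `k` sub-edges are open in `ω` crosses
  `[-a, a] × [-b, b]` — a self-avoiding open path first runs vertically to a coarse vertex of the
  left side (`coarse_start`) and then straight through every tuple it enters
  (`coarse_path_of_fine_path` of part 1);
* **coarse to fine** (`refineConfig_mem_crossing`): a crossing of `[-a, a] × [-b, b]` by
  `ω ⊆ E(ℤ²)` subdivides into a crossing of `[-ka, ka] × [-kb, kb]` by `refineConfig k ω`
  (the tree's subdivision map of `selfRefinementMeasure_one_zero`).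

References: Beffara 2008 §5.1 (the subdivided lattice); Kesten 1982 Ch. 5 (block arguments).
-/

namespace Summit.CriticalPhenomena.CardyFormulaZ2.Cruxes.CriticalPathRSW.FiniteSizeEnvelope

open Set
open Literature.Probability.LatticeModels Literature.Probability.Percolation
open SimpleGraph

/-! ### From the left side to the first coarse vertex -/

/-- A vertex both of whose coordinates are multiples of `k` is the coarse vertex `k (x / k)`. [folklore] -/
theorem eq_smul_ediv {k : ℕ} {x : Site 2} (h0 : (k : ℤ) ∣ x 0) (h1 : (k : ℤ) ∣ x 1) :
    x = (k : ℤ) • (fun i => x i / (k : ℤ) : Site 2) := by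
  funext i
  fin_cases i
  · simp [Int.mul_ediv_cancel' h0]
  · simp [Int.mul_ediv_cancel' h1]

/-- A vertex on a vertical coarse line is `k (x / k) + (x₁ mod k) e₁`. [folklore] -/
theorem eq_smul_ediv_add_single {k : ℕ} {x : Site 2} (h0 : (k : ℤ) ∣ x 0) :
    x = (k : ℤ) • (fun i => x i / (k : ℤ) : Site 2) + Pi.single 1 (x 1 % (k : ℤ)) := by
  funext i
  fin_cases i
  · simp [Int.mul_ediv_cancel' h0]
  · simp [Int.mul_ediv_add_emod]

/-- **From the left side to the first coarse vertex.** Let every open lattice edge of `ω` be axial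
for `k ≥ 2`, `a ≥ 1`. A self-avoiding walk of `ℤ²` with open edges from a vertex `x` of the line
`x₀ = -ka` to a vertex `y` of the line `y₀ = ka` first runs (vertically, straight) to a coarse
vertex `k u` of the line `x₀ = -ka`; the remainder is a sub-walk from `k u`. [folklore] -/
theorem coarse_start {k a : ℕ} (hk : 2 ≤ k) (ha : 1 ≤ a) {ω : BondConfig (Site 2)}
    (hax : ∀ e, cornerEdge e ∈ ω → IsAxialEdge k e) {x y : Site 2}
    (hx : x 0 = -((k : ℤ) * a)) (hy : y 0 = (k : ℤ) * a) (p : (zdGraph 2).Walk x y) (hp : p.IsPath)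
    (hω : ∀ e ∈ p.edges, e ∈ ω) :
    ∃ (u : Site 2) (q : (zdGraph 2).Walk ((k : ℤ) • u) y), u 0 = -(a : ℤ) ∧ q.IsPath ∧
      q.support ⊆ p.support ∧ ∀ e ∈ q.edges, e ∈ ω := by
  have hk0 : 0 < k := by omega
  have hk0' : (k : ℤ) ≠ 0 := by exact_mod_cast hk0.ne'
  have hkpos : (0 : ℤ) < k := by exact_mod_cast hk0
  have hka : (0 : ℤ) < (k : ℤ) * a := mul_pos hkpos (by exact_mod_cast ha)
  have hdiv0 : (k : ℤ) ∣ x 0 := ⟨-(a : ℤ), by rw [hx]; ring⟩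
  set u₀ : Site 2 := fun i => x i / (k : ℤ) with hu₀
  have hu₀0 : u₀ 0 = -(a : ℤ) := by
    simp only [hu₀]
    rw [hx, show -((k : ℤ) * a) = k * (-a) by ring, Int.mul_ediv_cancel_left _ hk0']
  by_cases hdiv1 : (k : ℤ) ∣ x 1
  · have hxu : x = (k : ℤ) • u₀ := eq_smul_ediv hdiv0 hdiv1
    exact ⟨u₀, p.copy hxu rfl, hu₀0, (Walk.isPath_copy _ _ _).2 hp,
      by intro v hv; rwa [Walk.support_copy] at hv, by rw [Walk.edges_copy]; exact hω⟩
  -- `x` is interior to the vertical tuple above `k u₀`, at height `j₀ = x₁ mod k`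
  obtain ⟨j₀, hj₀⟩ : ∃ j₀ : ℕ, (j₀ : ℤ) = x 1 % (k : ℤ) :=
    ⟨(x 1 % (k : ℤ)).toNat, Int.toNat_of_nonneg (Int.emod_nonneg _ hk0')⟩
  have hxdec : x = (k : ℤ) • u₀ + Pi.single 1 (j₀ : ℤ) := by
    rw [hj₀]; exact eq_smul_ediv_add_single hdiv0
  have hj₀pos : 0 < j₀ := by
    rcases Nat.eq_zero_or_pos j₀ with rfl | h
    · exact absurd (Int.dvd_of_emod_eq_zero (by exact_mod_cast hj₀.symm)) hdiv1
    · exact h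
  have hj₀lt : j₀ < k := by
    have := Int.emod_lt_of_pos (x 1) hkpos
    rw [← hj₀] at this
    exact_mod_cast this
  -- no vertex of the line `x₀ = -ka` is `y`
  have hyne : ∀ i : ℤ, (k : ℤ) • u₀ + Pi.single 1 i ≠ y := by
    intro i h'
    have h0 := congrArg (fun w : Site 2 => w 0) h'
    simp only [smul_add_single_one_apply_zero, hu₀0, hy] at h0
    linarith
  cases p with
  | nil => exact absurd (by rw [hxdec]) (hyne j₀)
  | cons h p' =>
    rename_i z
    have hp' := (Walk.cons_isPath_iff h p').1 hp
    have he : s(x, z) ∈ ω := hω _ (by simp [Walk.edges_cons])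
    have hω' : ∀ e ∈ p'.edges, e ∈ ω := fun e he' => hω e (by simp [Walk.edges_cons, he'])
    have hv : ¬ (k : ℤ) ∣ x 1 := hdiv1
    have hsupp : ∀ (w : Site 2) (q : (zdGraph 2).Walk w y), q.support ⊆ p'.support →
        q.support ⊆ (Walk.cons h p').support := fun w q hq v hv' => by
      rw [Walk.support_cons]; exact List.mem_cons_of_mem _ (hq hv')
    rcases eq_add_or_sub_single_of_adj hax hv h he with hz | hz
    · -- first step up: `z = k u₀ + (j₀ + 1) e₁`
      rw [hxdec, smul_add_single_add_single] at hz
      by_cases hjk : j₀ + 1 = k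
      · -- `z` is the coarse vertex `k (u₀ + e₁)`
        have hz' : z = (k : ℤ) • (u₀ + Pi.single 1 1) := by
          rw [hz, ← smul_add_single_self]; congr 2; exact_mod_cast hjk
        refine ⟨u₀ + Pi.single 1 1, p'.copy hz' rfl, by simpa using hu₀0, (Walk.isPath_copy _ _ _).2 hp'.1,
          ?_, by rw [Walk.edges_copy]; exact hω'⟩
        rw [Walk.support_copy]; exact hsupp _ p' (fun v hv' => hv')
      · set L : ℕ → Site 2 := fun i => (k : ℤ) • u₀ + Pi.single 1 (i : ℤ) with hL
        have hLk : L k = (k : ℤ) • (u₀ + Pi.single 1 1) := by rw [hL]; exact smul_add_single_self k u₀ 1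
        obtain ⟨q, hq, -, hqsupp, hqedges, -⟩ := straight_run (ω := ω) L
          (fun i w hi hik hadj hw => nb_up hax u₀ 1 i w hi hik hadj hw)
          (fun i _ _ => hyne i) (k - j₀ - 2) (j₀ + 1) (by omega) (by omega) p'
          (by rw [hz, hL]; push_cast; rfl) hp'.1 hω'
          (by rw [show j₀ + 1 - 1 = j₀ from rfl]; simp only [hL]; rw [← hxdec]; exact hp'.2)
        exact ⟨u₀ + Pi.single 1 1, q.copy hLk rfl, by simpa using hu₀0, (Walk.isPath_copy _ _ _).2 hq,
          by rw [Walk.support_copy]; exact hsupp _ q hqsupp,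
          by rw [Walk.edges_copy]; exact fun e he' => hω' e (hqedges he')⟩
    · -- first step down: `z = k u₀ + (j₀ - 1) e₁`
      rw [hxdec, smul_add_single_sub_single] at hz
      by_cases hj1 : j₀ = 1
      · subst hj1
        have hz' : z = (k : ℤ) • u₀ := by rw [hz]; simp
        refine ⟨u₀, p'.copy hz' rfl, hu₀0, (Walk.isPath_copy _ _ _).2 hp'.1, ?_,
          by rw [Walk.edges_copy]; exact hω'⟩
        rw [Walk.support_copy]; exact hsupp _ p' (fun v hv' => hv')
      · obtain ⟨m', hm'⟩ : ∃ m' : ℕ, m' + j₀ = k := ⟨k - j₀, by omega⟩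
        set L : ℕ → Site 2 := fun i => (k : ℤ) • u₀ + Pi.single 1 ((k : ℤ) - i) with hL
        have hLk : L k = (k : ℤ) • u₀ := by simp [hL]
        obtain ⟨q, hq, -, hqsupp, hqedges, -⟩ := straight_run (ω := ω) L
          (fun i w hi hik hadj hw => nb_down hax u₀ 1 i w hi hik hadj hw)
          (fun i _ _ => hyne _) (j₀ - 2) (m' + 1) (by omega) (by omega) p'
          (by rw [hz, hL, ← hm']; push_cast; ring_nf)
          hp'.1 hω'
          (by
            rw [show m' + 1 - 1 = m' from rfl, hL]
            have : (k : ℤ) - (m' : ℕ) = (j₀ : ℤ) := by rw [← hm']; push_cast; ring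
            simp only [this, ← hxdec]
            exact hp'.2)
        exact ⟨u₀, q.copy hLk rfl, hu₀0, (Walk.isPath_copy _ _ _).2 hq,
          by rw [Walk.support_copy]; exact hsupp _ q hqsupp,
          by rw [Walk.edges_copy]; exact fun e he' => hω' e (hqedges he')⟩

/-! ### Fine crossings give coarse crossings -/

/-- **Fine-to-coarse transfer of hard-way crossings.** Let `ω ⊆ E(ℤ²)` be a configuration all of
whose open edges are axial for `k ≥ 2`, and `ωc` a configuration of the coarse lattice (drawn on
`ℤ²`, `u ↦ k u`) containing the coarse edge `{u, u + e_d}` whenever the `k` sub-edges of its tuple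
are open in `ω`. If `ω` has an open left-right crossing of `[-ka, ka] × [-kb, kb]` (`a ≥ 1`), then
`ωc` has an open left-right crossing of `[-a, a] × [-b, b]`. [folklore] -/
theorem coarse_mem_crossing_of_fine {k a b : ℕ} (hk : 2 ≤ k) (ha : 1 ≤ a) {ω ωc : BondConfig (Site 2)}
    (hωE : ω ⊆ (zdGraph 2).edgeSet) (hax : ∀ e, cornerEdge e ∈ ω → IsAxialEdge k e)
    (hωc : ∀ (u : Site 2) (d : Fin 2), (∀ j : ℕ, j < k →
      s((k : ℤ) • u + Pi.single d (j : ℤ), (k : ℤ) • u + Pi.single d ((j : ℤ) + 1)) ∈ ω) →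
      s(u, u + Pi.single d 1) ∈ ωc)
    (h : ω ∈ KST2023.crossing (k * a) (k * b)) : ωc ∈ KST2023.crossing a b := by
  classical
  obtain ⟨x, ⟨-, hx0⟩, y, ⟨-, hy0⟩, hconn⟩ := h
  obtain ⟨p₀, hS₀, hω₀⟩ := exists_walk_of_mem_openConnIn hωE hconn
  have hx0' : x 0 = -((k : ℤ) * a) := by rw [hx0]; push_cast; ring
  have hy0' : y 0 = (k : ℤ) * a := by rw [hy0]; push_cast; ring
  obtain ⟨u, q, hu0, hq, hqsupp, hqω⟩ := coarse_start hk ha hax hx0' hy0' p₀.bypass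
    (Walk.bypass_isPath _) (fun e he => hω₀ e (Walk.edges_bypass_subset_edges _ he))
  obtain ⟨u', hu'0, hconn'⟩ := coarse_path_of_fine_path (b := b) hk hax hωc hy0' q.length u q rfl
    hq le_rfl (fun z hz => hS₀ z (Walk.support_bypass_subset_support _ (hqsupp hz))) hqω
  exact ⟨u, ⟨hconn'.1, hu0⟩, u', ⟨hconn'.2.1, hu'0⟩, hconn'⟩

/-! ### Coarse crossings give fine crossings (subdivision) -/

/-- The vertices of a subdivided coarse edge of the coarse box lie in the fine box. [folklore] -/
theorem smul_add_single_mem_box {k a b : ℕ} {u : Site 2} {d : Fin 2} (hu : u ∈ KST2023.box a b)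
    (hu' : u + Pi.single d 1 ∈ KST2023.box a b) {j : ℤ} (hj0 : 0 ≤ j) (hjk : j ≤ k) :
    (k : ℤ) • u + Pi.single d j ∈ KST2023.box (k * a) (k * b) := by
  rw [mem_box_iff'] at hu hu' ⊢
  have hk : (0 : ℤ) ≤ k := Nat.cast_nonneg k
  obtain ⟨h1, h2, h3, h4⟩ := hu
  have g1 := mul_le_mul_of_nonneg_left h1 hk
  have g2 := mul_le_mul_of_nonneg_left h2 hk
  have g3 := mul_le_mul_of_nonneg_left h3 hk
  have g4 := mul_le_mul_of_nonneg_left h4 hk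
  fin_cases d
  · obtain ⟨-, h2', -, -⟩ := hu'
    simp only [Fin.zero_eta, Pi.add_apply, Pi.single_eq_same] at h2'
    have g2' := mul_le_mul_of_nonneg_left h2' hk
    simp only [Fin.zero_eta, Pi.add_apply, Pi.smul_apply, smul_eq_mul, Pi.single_eq_same, Nat.cast_mul,
      Pi.single_eq_of_ne (show (1 : Fin 2) ≠ 0 by decide), add_zero]
    refine ⟨by linarith, by linarith, by linarith, by linarith⟩
  · obtain ⟨-, -, -, h4'⟩ := hu'
    simp only [Fin.mk_one, Pi.add_apply, Pi.single_eq_same] at h4'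
    have g4' := mul_le_mul_of_nonneg_left h4' hk
    simp only [Fin.mk_one, Pi.add_apply, Pi.smul_apply, smul_eq_mul, Pi.single_eq_same, Nat.cast_mul,
      Pi.single_eq_of_ne (show (0 : Fin 2) ≠ 1 by decide), add_zero]
    refine ⟨by linarith, by linarith, by linarith, by linarith⟩

/-- **An open coarse edge gives an open fine path through its tuple** in the subdivided
configuration `refineConfig k ω`: the sub-edge `(k u + j e_d, d)`, `0 ≤ j < k`, is axial with tuple
base `u` (floor division, as in the tree's `CardySelfRefinementExactEndpoints.tupleBase_smul_add`,
re-derived inline to keep the import cone small). [folklore] -/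
theorem refineConfig_mem_openConnIn_smul {k a b : ℕ} (hk : 0 < k) {ω : BondConfig (Site 2)} {u : Site 2}
    {d : Fin 2} (hu : u ∈ KST2023.box a b) (hu' : u + Pi.single d 1 ∈ KST2023.box a b)
    (he : s(u, u + Pi.single d 1) ∈ ω) :
    ∀ j : ℕ, j ≤ k → refineConfig k ω ∈
      openConnIn (KST2023.box (k * a) (k * b)) ((k : ℤ) • u) ((k : ℤ) • u + Pi.single d (j : ℤ)) := by
  have hk' : (k : ℤ) ≠ 0 := by exact_mod_cast hk.ne'
  -- the sub-edges are axial, with tuple base `u`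
  have hax : ∀ j : ℤ, IsAxialEdge k ((k : ℤ) • u + Pi.single d j, d) := fun j => by
    fin_cases d <;> simp [IsAxialEdge]
  have htb : ∀ j : ℤ, 0 ≤ j → j < k → tupleBase k ((k : ℤ) • u + Pi.single d j, d) = u := by
    intro j hj0 hjk
    funext i
    by_cases hi : i = d
    · subst hi
      simp only [tupleBase_apply, Pi.add_apply, Pi.smul_apply, smul_eq_mul, Pi.single_eq_same]
      rw [add_comm, Int.add_mul_ediv_left _ _ hk', Int.ediv_eq_zero_of_lt hj0 hjk, zero_add]
    · simp only [tupleBase_apply, Pi.add_apply, Pi.smul_apply, smul_eq_mul, Pi.single_eq_of_ne hi,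
        add_zero]
      exact Int.mul_ediv_cancel_left _ hk'
  intro j
  induction j with
  | zero =>
    intro _
    simp only [Nat.cast_zero, Pi.single_zero, add_zero]
    exact openConnIn_refl ((smul_mem_box_iff hk).2 hu)
  | succ j ih =>
    intro hj
    refine PlanarDuality.openConnIn_trans (ih (by omega)) (openConnIn_of_adj ?_ ?_ ?_ ?_)
    · exact smul_add_single_mem_box hu hu' (by positivity) (by exact_mod_cast (by omega : j ≤ k))
    · exact smul_add_single_mem_box hu hu' (by positivity) (by exact_mod_cast hj)
    · have h := (cornerEdge_mem_refineConfig_iff k ω ((k : ℤ) • u + Pi.single d (j : ℤ), d)).2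
        ⟨hax j, by rw [htb j (by positivity) (by exact_mod_cast (by omega : j < k))]; exact he⟩
      rw [cornerEdge, smul_add_single_add_single] at h
      push_cast
      exact h
    · intro h'
      have := congrArg (fun x : Site 2 => x d) h'
      simp at this

/-- **Coarse-to-fine transfer along an open walk**: subdividing every coarse edge. [folklore] -/
theorem refineConfig_mem_openConnIn_of_walk {k a b : ℕ} (hk : 0 < k) {ω : BondConfig (Site 2)} :
    ∀ {v y : Site 2} (p : (zdGraph 2).Walk v y), (∀ z ∈ p.support, z ∈ KST2023.box a b) →
      (∀ e ∈ p.edges, e ∈ ω) →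
      refineConfig k ω ∈ openConnIn (KST2023.box (k * a) (k * b)) ((k : ℤ) • v) ((k : ℤ) • y) := by
  intro v y p
  induction p with
  | nil => exact fun hS _ => openConnIn_refl ((smul_mem_box_iff hk).2 (hS _ (by simp)))
  | cons h p' ih =>
    rename_i v z y'
    intro hS hω
    have hv : v ∈ KST2023.box a b := hS _ (by simp)
    have hzb : z ∈ KST2023.box a b := hS _ (by simp)
    have he : s(v, z) ∈ ω := hω _ (by simp [Walk.edges_cons])
    have ih' := ih (fun w hw => hS w (by simp [hw])) (fun e he' => hω e (by simp [Walk.edges_cons, he']))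
    refine PlanarDuality.openConnIn_trans ?_ ih'
    obtain ⟨d, hz | hz⟩ := (zdGraph_adj_iff _ _).1 h
    · subst hz
      have h1 := refineConfig_mem_openConnIn_smul hk hv hzb he k le_rfl
      rwa [smul_add_single_self] at h1
    · subst hz
      rw [Sym2.eq_swap] at he
      have h1 := refineConfig_mem_openConnIn_smul hk hzb hv he k le_rfl
      rw [smul_add_single_self] at h1
      rwa [openConnIn_comm]

/-- **Coarse-to-fine transfer of crossings**: if `ω ⊆ E(ℤ²)` has an open left-right crossing of
`[-a, a] × [-b, b]`, its subdivision `refineConfig k ω` (`k ≥ 1`) has an open left-right crossing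
of `[-ka, ka] × [-kb, kb]`. [folklore] -/
theorem refineConfig_mem_crossing {k a b : ℕ} (hk : 0 < k) {ω : BondConfig (Site 2)}
    (hωE : ω ⊆ (zdGraph 2).edgeSet) (h : ω ∈ KST2023.crossing a b) :
    refineConfig k ω ∈ KST2023.crossing (k * a) (k * b) := by
  obtain ⟨x, ⟨hxbox, hx0⟩, y, ⟨hybox, hy0⟩, hconn⟩ := h
  obtain ⟨p, hS, hω⟩ := exists_walk_of_mem_openConnIn hωE hconn
  refine ⟨(k : ℤ) • x, ⟨(smul_mem_box_iff hk).2 hxbox, ?_⟩, (k : ℤ) • y,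
    ⟨(smul_mem_box_iff hk).2 hybox, ?_⟩, refineConfig_mem_openConnIn_of_walk hk p hS hω⟩
  · simp [hx0]
  · simp [hy0]

/-! ### Registered sub-goal -/

/-- **Registered sub-goal `stub_phaseDiagramLandmarksB_transfer`** (serves stub
`stub_phaseDiagramLandmarksB` of stmt-CriticalPhenomena-10267): the two deterministic transfers of
box crossings between `ℤ²` and `kℤ²` — fine-to-coarse for all-axial configurations and fully open
tuples (`coarse_mem_crossing_of_fine`, `k ≥ 2`, `a ≥ 1`), and coarse-to-fine by subdivision
(`refineConfig_mem_crossing`, `k ≥ 1`). [folklore] -/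
theorem stub_phaseDiagramLandmarksB_transfer :
    (∀ (k a b : ℕ), 2 ≤ k → 1 ≤ a → ∀ (ω ωc : BondConfig (Site 2)), ω ⊆ (zdGraph 2).edgeSet →
      (∀ e, cornerEdge e ∈ ω → IsAxialEdge k e) →
      (∀ (u : Site 2) (d : Fin 2), (∀ j : ℕ, j < k →
        s((k : ℤ) • u + Pi.single d (j : ℤ), (k : ℤ) • u + Pi.single d ((j : ℤ) + 1)) ∈ ω) →
        s(u, u + Pi.single d 1) ∈ ωc) →
      ω ∈ KST2023.crossing (k * a) (k * b) → ωc ∈ KST2023.crossing a b) ∧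
    (∀ (k a b : ℕ), 0 < k → ∀ ω : BondConfig (Site 2), ω ⊆ (zdGraph 2).edgeSet →
      ω ∈ KST2023.crossing a b → refineConfig k ω ∈ KST2023.crossing (k * a) (k * b)) :=
  ⟨fun _ _ _ hk ha _ _ hE hax hωc h => coarse_mem_crossing_of_fine hk ha hE hax hωc h,
    fun _ _ _ hk _ hE h => refineConfig_mem_crossing hk hE h⟩

end Summit.CriticalPhenomena.CardyFormulaZ2.Cruxes.CriticalPathRSW.FiniteSizeEnvelope
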